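import Literature.MathematicalPhysics.QuantumFieldTheory.Balaban1983to89.B12SmallFieldDomain259
import Literature.MathematicalPhysics.QuantumFieldTheory.Balaban1983to89.B15DeterminingSets
import Literature.MathematicalPhysics.QuantumFieldTheory.Balaban1983to89.B10NestedMinimizer
import Literature.MathematicalPhysics.QuantumFieldTheory.Balaban1983to89.B8Eq110UnitaryProof

/-!
# `Balaban1983to89.B12CriticalPoint23` — [Balaban1987RG1] (2.2)–(2.3) p. 265 PROVED from the named inputs: the
# critical configuration `V^{(k)} = M^k(U_{k+1}(W))` IS the unique minimum of `V ↦ 𝐆(V) + A(U_k(V))` on `{V̄ = W}`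

HONEST FRAMING (cell `lit-balaban`, verbatim): statement-level skeleton of published theorems with citation tags;
proofs where landed; nothing here is a claim about the Yang–Mills mass gap.

CITATION HEADER.  T. Bałaban, *Renormalization group approach to lattice gauge field theories. I. Generation of
effective actions in a small field approximation and a coupling constant renormalization in four dimensions*, Commun.
Math. Phys. **109** (1987) 249–301, doi:10.1007/bf01215223 [Balaban1987RG1] (cell paper B12 = «[I]»; PDF held
`paper:balaban1987-cmp109-rg-i-small-field`, journal page = PDF page + 248; p. 265 = PDF p. 17 re-read for this file).
T. Bałaban, *The variational problem and background fields in renormalization group method for lattice gauge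
theories*, Commun. Math. Phys. **102** (1985) 277–309, doi:10.1007/bf01229381 [Balaban1985Variational] (= [15] of
[I], cell paper B11; PDF held `paper:balaban1985-cmp102-variational-background`, journal page = PDF page + 276; pp.
278–279, 281 re-read).  Unit `lit-balaban-r09` gen 12 (reader/typer of CMP 109, display owner of block B12; TAKING
line `HOME/STATUS.md` 2026-08-22T01:07:32Z), HOME `run/shared/lean/pub/lit-balaban/`; SKELETON row `B12.Eq2.2-2.3`
(head `typed p239194` = `B12SmallFieldDomain259.CriticalPoint23`, statement only, now INHABITED).

WHAT IS PRINTED (verbatim).  [I] p. 265: *«We consider the new action on regular configurations W defined on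
T^{(k+1)}. More exactly we assume that W is so regular that the minimal configurations U_{k+1}(W) exist and belong
to the space U_{k+1}(ε₀). … We calculate the integral (2.1) applying the saddle point method. At first we look for
critical points of the function V → 𝐆(V) + A(U_k(V)), V : V̄ = W. (2.2)  Under the above regularity assumptions
there exists the exactly one critical point, which is obtained by taking the critical orbit of the function
A(U_k(V)) considered on the subspace, and choosing the element of the orbit satisfying the axial gauge conditions
𝐆(V) = 0. This critical configuration, which is a minimum of the function (2.2), is denoted by V^{(k)} = V^{(k)}(W),
and is related to the minimal configuration U_{k+1}(W) in the axial gauge by the equality V^{(k)} = Ū^k_{k+1} =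
M^k(U_{k+1}). (2.3)»*.  [15] p. 278: *«the space 𝔅_k(𝔅_k, V) is invariant with respect to gauge transformations u
satisfying u(y) = 1 for y ∈ 𝔅_k. (4) … This space and the action (5) are invariant with respect to the gauge
transformations (4). These transformations form a group and the space (6) is a union of orbits of this group. Our
problem is to find all critical orbits of the functional (5). We will prove that for ε₀ sufficiently small there is
at most one critical orbit. … we will prove that there exists a minimal orbit.»*; Theorem 1 p. 279: *«there exists a
minimal orbit in the space 𝔘_k({Ω_j}, B₃ε₁) ∩ 𝔅_k(𝔅_k, V). (8)  This orbit is a unique critical orbit in the space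
(6) if B₃ε₁ ≤ ε₀ and ε₀ ≤ a₀.»*; p. 281: *«We will prove that for ε₁, ε₂ sufficiently small there exists exactly one
critical configuration, which is a minimum of the functional (5).»*

THE INPUTS, NAMED (nothing of [15] is proved here).  (i) EXISTENCE of the minimal configurations = the tree's
background DATA `Setup.Background` (`bg.U k V = U_k(V)` with `Setup.IsBackground`: `M^k(U_k(V)) = V`, `U_k(V)`
regular, `A(U_k(V)) ≤ A(U)` for every regular `U` with `M^k(U) = V` — [15] Thm 1 (8), quoted as a leaf by `Setup`).
(ii) UNIQUENESS OF THE CRITICAL (minimal) ORBIT UNDER [15]'s GAUGE GROUP (4) at level `k+1` — the hypothesis `huniq`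
of `criticalPoint23`: every regular minimiser with `M^{k+1}(U₁) = W` is `U_{k+1}(W)^u` for a gauge transformation
`u` of `T_η` with `u(y) = 1` at the sites `y ∈ T^{(k+1)} ⊂ T_η` (the inclusion is the tree's
`B15DeterminingSets.embIter`).  This is the orbit notion PRINTED on [15] p. 278 (the group (4)); the tree's weaker
hypothesis `B12EuclClause263.UniqueModGauge` (any `u`) does NOT suffice for (2.2)'s «exactly one» (see divergence
(b)).  (iii) THE AXIAL-GAUGE REPRESENTATIVE: `U_{k+1}(W)` is «the minimal configuration in the axial gauge», read
as: its `k`-fold average `M^k(U_{k+1}(W))` satisfies the block axial gauge conditions of `T^{(k)}` relative to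
`T^{(k+1)}` (`Setup.AxialGauge cd`, i.e. `𝐆 = 0` — `gaugeFixFn_eq_zero_iff_axialGauge`).  (iv) THE REGULARITY
ASSUMPTIONS («Under the above regularity assumptions»): print's regular class `reg` of `V`'s on the surface lies in
the domain where `U_k(·)` is a minimiser (`bg.dom k`), and `V^{(k)}` itself is regular and in that domain.
(v) FAITHFULNESS OF THE NORMALISED TRACE, «Re tr g = 1 only at g = 1» — true in every `G ⊂ U(N)` with [I]'s
`tr 1 = 1` (p. 252); a hypothesis on the abstract `Setup.GaugeGroup` interface (which only knows `Re tr g ≤ 1`),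
DISCHARGED for the tree's instances `U(N)`, `SU(N)` (`eq_one_of_reTr_eq_one_unitaryGroup`,
`…_specialUnitaryGroup`, from `B8Eq110UnitaryProof.cmp'_unitaryGroup`).  (vi) the standing range `k + 1 ≤ m + K` of
the lattices (`Setup.Params`; needed for `blockOf ∘ emb = id` and the covariance field of `Setup.Averaging`).

THE ARGUMENT FORMALISED (print's two sentences, made explicit).  § 1: `𝐆(V) = Σ_y Σ_{x∈B(y),x≠y}[1 − Re tr V(y,x)]
≥ 0`, and `𝐆(V) = 0 ⇔ V` is in the block axial gauge (faithfulness (v)).  § 2: the `k`-fold average is covariant,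
`M^k(U^u) = (M^k U)^{u↾T^{(k)}}` (iterating the covariance field of `Setup.Averaging`; `u↾T^{(k)} = u ∘ embIter k`).
§ 3: the tree's background data is an instance of the abstract two-level minimisation carrier
`B10NestedMinimizer.LevelMin` of the pub-balaban B10 sub-cell (its § 3 records (2.2)–(2.3) as «the d = 4 twin …
recorded, not typed» — typed HERE, consuming `LevelMin.isMinOn_eff_datum` BY NAME): `U_{k+1}(W)` minimises `A` over
the composite region, hence `V^{(k)} = M^k(U_{k+1}(W))` minimises `V ↦ A(U_k(V))` over the regular `V` with `V̄ = W`,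
with the chain `A(U_k(V^{(k)})) ≤ A(U_{k+1}(W)) ≤ A(U_k(V))`.  § 4 (the theorem): `V̄^{(k)} = M^{k+1}(U_{k+1}(W)) =
W`; `𝐆(V^{(k)}) = 0` by (iii); minimality of the sum from § 1 + § 3; UNIQUENESS: if `V` regular, `V̄ = W` and
`𝐆(V) + A(U_k(V)) = 𝐆(V^{(k)}) + A(U_k(V^{(k)}))`, then both inequalities are equalities, so `𝐆(V) = 0` and `U_k(V)`
is a regular minimiser at level `k+1` for `W`; by (ii) `U_k(V) = U_{k+1}(W)^u` with `u = 1` on `T^{(k+1)}`; by § 2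
`V = M^k(U_k(V)) = (V^{(k)})^{u↾T^{(k)}}`; both `V` and `V^{(k)}` are in the block axial gauge, so for `x ∈ B(y)`,
`x ≠ y`: `1 = V(y,x) = u(y)·V^{(k)}(y,x)·u(x)⁻¹ = u(x)⁻¹` (covariance field of `Setup.ContourData`, `u(y) = 1`), i.e.
`u↾T^{(k)} ≡ 1` and `V = V^{(k)}` — print's «choosing the element of the orbit satisfying the axial gauge conditions».
§ 5: the `U(N)`/`SU(N)` forms with (v) discharged.

WHAT IS PROVED: theorems only (no definition, no `Prop`-fact, no sorry; axioms `propext`, `Classical.choice`,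
`Quot.sound`): **`criticalPoint23`** (= `B12SmallFieldDomain259.CriticalPoint23 av bg k cd reg W` from (i)–(vi)),
`criticalPoint23_unitaryGroup`, `criticalPoint23_specialUnitaryGroup`; the lemmas `gaugeFixFn_nonneg`,
`gaugeFixFn_eq_zero_iff_axialGauge`, `iter_gaugeAct`, `levelMin_of_background`, `isMinOn_compSp_usucc`,
`isMinOn_eff_vk`, `action_chain`, `eq_one_of_reTr_eq_one_unitaryGroup`/`_specialUnitaryGroup`.

DIVERGENCES FROM PRINT / HONEST SCOPE.  (a) «critical point» is read, as in the typed statement p239194 and as print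
itself continues («which is a minimum of the function (2.2)»), as MINIMUM: existence, identification (2.3) and
uniqueness of the minimum are proved; that there is no other CRITICAL (non-minimal) point is [15]'s «unique critical
orbit» one level up and is not re-derived for the function (2.2) (no differential structure on the abstract `G`).
(b) The uniqueness input is [15] Thm 1's clause with the gauge group (4) PRINTED in [15] (`u = 1` on the coarse
lattice); with uniqueness modulo ALL gauge transformations only `V = (V^{(k)})^{u}` with `u` block-constant and
`W^{u} = W` would follow, and for `W` with a non-trivial stabiliser that is genuinely weaker — print's «exactly one»
uses (4).  (c) The regular class `reg` and the domains are abstract sets (the tree's `Background.dom`,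
`CriticalPoint23`'s `reg`), related by the hypotheses (iv); print's `U_{k+1}(ε₀)`-regularity of `W` is not
quantified here.  (d) Abstract one-step averaging/contour data of `Setup` (any `Averaging`, `ContourData`); for the
cell's concrete (0.11)/(0.12) lineage on `ℤᵈ` the same bookkeeping applies verbatim but is not restated.

v1.1 (unit `lit-balaban-r09` gen 13; v1.0 = p312777): DOCSTRING-ONLY — the [12] = [Balaban1985Averaging] locator of
`iter_gaugeAct` «(11) p.18» → «(11) p.19» (CMP 98 p. 19 carries (10)–(13), p. 18 ends with (9); CITELOC row P40-002
of `pub-balaban` summit-lit1 gen 40, read on the page image `cmp_png/B7/p003.png`); no declaration, statement or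
proof changed.
-/

namespace Literature.MathematicalPhysics.QuantumFieldTheory.Balaban1983to89.B12CriticalPoint23

open B12SmallFieldDomain259 (CriticalPoint23)
open B15DeterminingSets (embIter)
open B10NestedMinimizer (LevelMin compSp effFib)

variable {P : Params} {G : Type*} [GaugeGroup G]

/-! ## § 1  The gauge-fixing function `𝐆(V)`: non-negative, vanishing exactly on the block axial gauge -/

section GaugeFix

variable {j : ℕ}

/-- [cite: Balaban1987RG1, (0.17) p.255][cite: Balaban1987RG1, (2.2) p.265] `𝐆(Y, V) = Σ_{y∈Y} Σ_{x∈B(y), x≠y}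
[1 − Re tr V(y,x)] ≥ 0` (each term is `≥ 0` by `Re tr ≤ 1`). -/
theorem gaugeFixFn_nonneg (cd : ContourData P j G) (Y : Finset (Site P (j+1))) (U : GaugeField P j G) :
    0 ≤ gaugeFixFn cd Y U := by
  unfold gaugeFixFn
  refine Finset.sum_nonneg fun y _ => Finset.sum_nonneg fun x _ => ?_
  have := GaugeGroup.reTr_le_one (cd.holTo U y x)
  linarith

/-- [cite: Balaban1987RG1, (2.2) p.265] a configuration in the block axial gauge (`V(y,x) = 1`, `x ∈ B(y)`, `x ≠ y`)
has `𝐆(V) = 0` («the axial gauge conditions 𝐆(V) = 0», easy direction). -/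
theorem gaugeFixFn_eq_zero_of_axialGauge (cd : ContourData P j G) {U : GaugeField P j G} (h : AxialGauge cd U)
    (Y : Finset (Site P (j+1))) : gaugeFixFn cd Y U = 0 := by
  unfold gaugeFixFn
  refine Finset.sum_eq_zero fun y _ => Finset.sum_eq_zero fun x hx => ?_
  rw [Finset.mem_erase] at hx
  have hb : blockOf x = y := (Finset.mem_filter.1 hx.2).2
  rw [h y x hb hx.1, GaugeGroup.reTr_one, sub_self]

/-- [cite: Balaban1987RG1, (2.2) p.265] **«the axial gauge conditions 𝐆(V) = 0»**: for a gauge group in which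
`Re tr g = 1` only at `g = 1` (every `G ⊂ U(N)` with the normalised trace, p. 252), `𝐆(V) = 0` (sum over ALL blocks)
holds EXACTLY for the configurations in the block axial gauge `Setup.AxialGauge`. -/
theorem gaugeFixFn_eq_zero_iff_axialGauge (hG : ∀ g : G, reTr g = 1 → g = 1) (cd : ContourData P j G)
    (U : GaugeField P j G) : gaugeFixFn cd Finset.univ U = 0 ↔ AxialGauge cd U := by
  refine ⟨fun h y x hb hne => ?_, fun h => gaugeFixFn_eq_zero_of_axialGauge cd h _⟩
  have hterm : ∀ y' ∈ (Finset.univ : Finset (Site P (j+1))), ∀ x' ∈ (block y').erase (emb y'),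
      0 ≤ 1 - reTr (cd.holTo U y' x') := by
    intro y' _ x' _
    have := GaugeGroup.reTr_le_one (cd.holTo U y' x')
    linarith
  have hy : ∑ x' ∈ (block y).erase (emb y), (1 - reTr (cd.holTo U y x')) = 0 := by
    unfold gaugeFixFn at h
    exact (Finset.sum_eq_zero_iff_of_nonneg (fun y' hy' => Finset.sum_nonneg (hterm y' hy'))).1 h y
      (Finset.mem_univ y)
  have hx : x ∈ (block y).erase (emb y) :=
    Finset.mem_erase.2 ⟨hne, Finset.mem_filter.2 ⟨Finset.mem_univ _, hb⟩⟩
  have h0 := (Finset.sum_eq_zero_iff_of_nonneg (hterm y (Finset.mem_univ y))).1 hy x hx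
  exact hG _ (by linarith)

end GaugeFix

/-! ## § 1b  Faithfulness of the normalised trace in the tree's matrix instances `U(N)`, `SU(N)` -/

section Faithful

open Literature.MathematicalPhysics.QuantumLattice
open scoped Matrix.Norms.L2Operator

variable {n : Type*} [DecidableEq n] [Fintype n] [Nonempty n]

/-- [cite: Balaban1987RG1, (0.2) p.252] in `U(N)` with `reTr g = Re Tr g / N` (the tree's instance
`UnitaryModel.instGaugeGroupUnitaryGroup`): `Re tr g = 1 ⇒ g = 1` (from `(dist1 g)² ≤ 2N(1 − Re tr g)`,
`B8Eq110UnitaryProof.cmp'_unitaryGroup`, and `dist1 g = ‖g − 1‖`). -/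
theorem eq_one_of_reTr_eq_one_unitaryGroup (g : Matrix.unitaryGroup n ℂ) (h : reTr g = 1) : g = 1 := by
  have h1 := B8Eq110UnitaryProof.cmp'_unitaryGroup (n := n) g
  rw [h, sub_self, mul_zero] at h1
  have h2 : dist1 g = 0 := by
    have h3 := GaugeGroup.dist1_nonneg g
    nlinarith
  have h4 : ‖((g : Matrix n n ℂ)) - 1‖ = 0 := h2
  rw [norm_eq_zero, sub_eq_zero] at h4
  exact Subtype.ext h4

/-- [cite: Balaban1987RG1, (0.2) p.252] the same in `SU(N)` (instance `UnitaryModel.instGaugeGroupSpecialUnitaryGroup`). -/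
theorem eq_one_of_reTr_eq_one_specialUnitaryGroup (g : Matrix.specialUnitaryGroup n ℂ) (h : reTr g = 1) :
    g = 1 := by
  have h1 := B8Eq110UnitaryProof.cmp'_specialUnitaryGroup (n := n) g
  rw [h, sub_self, mul_zero] at h1
  have h2 : dist1 g = 0 := by
    have h3 := GaugeGroup.dist1_nonneg g
    nlinarith
  have h4 : ‖(g : Matrix n n ℂ) - 1‖ = 0 := h2
  rw [norm_eq_zero, sub_eq_zero] at h4
  exact Subtype.ext h4

end Faithful

/-! ## § 2  Covariance of the `k`-fold average: `M^k(U^u) = (M^k U)^{u ↾ T^{(k)}}` -/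

section IterCov

/-- [cite: Balaban1987RG1, p.254][cite: Balaban1985Averaging, (11) p.19] **the `k`-fold average is gauge covariant**,
`M^k(U^u) = (M^kU)^{u∘ι_k}` with `ι_k : T^{(k)} ⊂ T_η` the inclusion of the `k`-th lattice into the finest one
(`B15DeterminingSets.embIter`) — iterating the covariance field of `Setup.Averaging` through the levels `j < k ≤ m+K`. -/
theorem iter_gaugeAct (av : ∀ j, Averaging P j G) :
    ∀ (k : ℕ), k ≤ P.m + P.K → ∀ (u : GaugeTransf P 0 G) (U : GaugeField P 0 G),
      Averaging.iter av k (GaugeField.gaugeAct u U)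
        = GaugeField.gaugeAct (fun x => u (embIter k x)) (Averaging.iter av k U)
  | 0, _, _, _ => rfl
  | k + 1, hk, u, U => by
      show (av k).avg (Averaging.iter av k (GaugeField.gaugeAct u U))
        = GaugeField.gaugeAct (fun x => u (embIter k (emb x))) ((av k).avg (Averaging.iter av k U))
      rw [iter_gaugeAct av k (Nat.le_of_succ_le hk) u U, (av k).covariant hk]

end IterCov

/-! ## § 3  The background data as a two-level minimisation problem (`B10NestedMinimizer.LevelMin`) and the chain
`A(U_k(V^{(k)})) ≤ A(U_{k+1}(W)) ≤ A(U_k(V))` -/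

section Chain

variable {av : ∀ j, Averaging P j G}

/-- [cite: Balaban1985Variational, Thm 1 (8) p.279][cite: Balaban1987RG1, (0.21) p.256] the tree's background DATA at
level `k` is an instance of the abstract level-`k` minimality package of `B10NestedMinimizer` (configurations on
`T_η`, data `V` on `T^{(k)}`, datum map `M^k`, comparison region the regular class, admissible data the domain,
minimiser map `U_k(·)`). -/
theorem levelMin_of_background (bg : Background P G av) (k : ℕ) :
    LevelMin wilsonAction4 (Averaging.iter av k) (fun _ => bg.reg) (bg.dom k) (bg.U k) where
  mem V hV := (bg.isBackground k V hV).2.1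
  datum V hV := (bg.isBackground k V hV).1
  isMin V hV U hU hUV := (bg.isBackground k V hV).2.2 U hU hUV

/-- [cite: Balaban1987RG1, (2.3) p.265][cite: Balaban1985Variational, Thm 1 (8) p.279] `U_{k+1}(W)` lies in the
composite comparison region over `W` (regular, `M^k(U_{k+1}(W))` in the level-`k` domain, `M^{k+1}(U_{k+1}(W)) = W`)
and MINIMISES the action there (the region is part of the level-`(k+1)` constraint surface within the regular class). -/
theorem isMinOn_compSp_usucc (bg : Background P G av) (k : ℕ) {W : GaugeField P (k+1) G} (hW : W ∈ bg.dom (k+1))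
    (hVk : Averaging.iter av k (bg.U (k+1) W) ∈ bg.dom k) :
    bg.U (k+1) W ∈ compSp (fun _ => bg.reg) (Averaging.iter av k) (av k).avg (bg.dom k) W ∧
      IsMinOn wilsonAction4 (compSp (fun _ => bg.reg) (Averaging.iter av k) (av k).avg (bg.dom k) W)
        (bg.U (k+1) W) := by
  have hb := bg.isBackground (k+1) W hW
  refine ⟨⟨hb.2.1, hVk, hb.1⟩, isMinOn_iff.2 fun U hU => hb.2.2 U hU.1 hU.2.2⟩

/-- [cite: Balaban1987RG1, (2.2)–(2.3) p.265] **`V^{(k)} = M^k(U_{k+1}(W))` minimises `V ↦ A(U_k(V))` over the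
level-`k` domain on the surface `{V̄ = W}`** — `B10NestedMinimizer.LevelMin.isMinOn_eff_datum` (TOP-DOWN direction
of the two-level bookkeeping) at the tree's background data. -/
theorem isMinOn_eff_vk (bg : Background P G av) (k : ℕ) {W : GaugeField P (k+1) G} (hW : W ∈ bg.dom (k+1))
    (hVk : Averaging.iter av k (bg.U (k+1) W) ∈ bg.dom k) :
    IsMinOn (wilsonAction4 ∘ bg.U k) (effFib (av k).avg (bg.dom k) W) (Averaging.iter av k (bg.U (k+1) W)) :=
  ((levelMin_of_background bg k).isMinOn_eff_datum (av k).avg (isMinOn_compSp_usucc bg k hW hVk).1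
    (isMinOn_compSp_usucc bg k hW hVk).2).2

/-- [cite: Balaban1987RG1, (2.2)–(2.3) p.265][cite: Balaban1985Variational, Thm 1 (8) p.279] **THE CHAIN**
`A(U_k(V^{(k)})) ≤ A(U_{k+1}(W)) ≤ A(U_k(V))` for every `V` of the level-`k` domain with `V̄ = W`: the first because
`U_{k+1}(W)` is a regular configuration with `M^k(U_{k+1}(W)) = V^{(k)}`, the second because `U_k(V)` is a regular
configuration with `M^{k+1}(U_k(V)) = V̄ = W`. -/
theorem action_chain (bg : Background P G av) (k : ℕ) {W : GaugeField P (k+1) G} (hW : W ∈ bg.dom (k+1))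
    (hVk : Averaging.iter av k (bg.U (k+1) W) ∈ bg.dom k) {V : GaugeField P k G} (hV : V ∈ bg.dom k)
    (hVW : (av k).avg V = W) :
    wilsonAction4 (bg.U k (Averaging.iter av k (bg.U (k+1) W))) ≤ wilsonAction4 (bg.U (k+1) W) ∧
      wilsonAction4 (bg.U (k+1) W) ≤ wilsonAction4 (bg.U k V) := by
  have hb1 := bg.isBackground (k+1) W hW
  have hbk := bg.isBackground k V hV
  refine ⟨(bg.isBackground k _ hVk).2.2 _ hb1.2.1 rfl, hb1.2.2 _ hbk.2.1 ?_⟩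
  show (av k).avg (Averaging.iter av k (bg.U k V)) = W
  rw [hbk.1, hVW]

end Chain

/-! ## § 4  [I] (2.2)–(2.3): `B12SmallFieldDomain259.CriticalPoint23` INHABITED from the named inputs -/

section Main

variable {av : ∀ j, Averaging P j G}

/-- [cite: Balaban1987RG1, (2.2)–(2.3) p.265][cite: Balaban1985Variational, Thm 1 p.279][cite: Balaban1985Variational,
(4) p.278] **[I] (2.2)–(2.3): «Under the above regularity assumptions there exists the exactly one critical point,
which is obtained by taking the critical orbit of the function A(U_k(V)) considered on the subspace, and choosing
the element of the orbit satisfying the axial gauge conditions 𝐆(V) = 0. This critical configuration, which is a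
minimum of the function (2.2), … is related to the minimal configuration U_{k+1}(W) in the axial gauge by the
equality V^{(k)} = Ū^k_{k+1} = M^k(U_{k+1}). (2.3)»** — the typed statement `CriticalPoint23 av bg k cd reg W`
(p239194: `V^{(k)} := M^k(U_{k+1}(W))` has `V̄^{(k)} = W`, `𝐆(V^{(k)}) = 0`, is regular, minimises `𝐆(V) + A(U_k(V))`
over the regular `V` with `V̄ = W`, and is the ONLY minimum there) HOLDS, given: the standing range `k+1 ≤ m+K`;
faithfulness of the normalised trace (`Re tr g = 1 ⇒ g = 1`, every `G ⊂ U(N)`); `W` in the background domain of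
level `k+1` ([15] Thm 1 existence for `W`: «W is so regular that the minimal configurations U_{k+1}(W) exist»);
`V^{(k)}` in the level-`k` domain and in the regular class; the regular class on the surface inside the level-`k`
domain («the above regularity assumptions»); `V^{(k)}` in the block axial gauge (the axial representative
`U_{k+1}(W)`); and [15] Thm 1's UNIQUENESS OF THE CRITICAL ORBIT at level `k+1` under [15]'s gauge group (4) — every
regular minimiser `U₁` with `M^{k+1}(U₁) = W` is `U_{k+1}(W)^u` with `u = 1` on `T^{(k+1)} ⊂ T_η`. -/
theorem criticalPoint23 (hG : ∀ g : G, reTr g = 1 → g = 1) (bg : Background P G av) {k : ℕ}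
    (hk : k + 1 ≤ P.m + P.K) (cd : ContourData P k G) (reg : Set (GaugeField P k G))
    {W : GaugeField P (k+1) G} (hW : W ∈ bg.dom (k+1))
    (hVk_dom : Averaging.iter av k (bg.U (k+1) W) ∈ bg.dom k)
    (hVk_reg : Averaging.iter av k (bg.U (k+1) W) ∈ reg)
    (hreg : ∀ V ∈ reg, (av k).avg V = W → V ∈ bg.dom k)
    (hax : AxialGauge cd (Averaging.iter av k (bg.U (k+1) W)))
    (huniq : ∀ U₁ : GaugeField P 0 G, IsBackground av bg.reg (k+1) W U₁ →
      ∃ u : GaugeTransf P 0 G, (∀ y : Site P (k+1), u (embIter (k+1) y) = 1) ∧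
        U₁ = GaugeField.gaugeAct u (bg.U (k+1) W)) :
    CriticalPoint23 av bg k cd reg W := by
  -- notation: `Vk = V^{(k)} := M^k(U_{k+1}(W))`, `U₁ := U_{k+1}(W)`
  set U₁ := bg.U (k+1) W with hU₁
  set Vk := Averaging.iter av k U₁ with hVkdef
  have hb1 := bg.isBackground (k+1) W hW
  have havg : (av k).avg Vk = W := hb1.1
  have hG0 : gaugeFixFn cd Finset.univ Vk = 0 := gaugeFixFn_eq_zero_of_axialGauge cd hax _
  refine ⟨havg, hG0, hVk_reg, fun V hVreg hVW => ?_⟩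
  have hVdom : V ∈ bg.dom k := hreg V hVreg hVW
  have hchain := action_chain bg k hW hVk_dom hVdom hVW
  have hGV := gaugeFixFn_nonneg cd Finset.univ V
  refine ⟨by rw [hG0]; linarith [hchain.1, hchain.2], fun heq => ?_⟩
  -- uniqueness: both inequalities are equalities
  rw [hG0, zero_add] at heq
  have hGV0 : gaugeFixFn cd Finset.univ V = 0 := by linarith [hchain.1, hchain.2]
  have hAeq : wilsonAction4 (bg.U k V) = wilsonAction4 U₁ := by linarith [hchain.1, hchain.2]
  have haxV : AxialGauge cd V := (gaugeFixFn_eq_zero_iff_axialGauge hG cd V).1 hGV0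
  -- `U_k(V)` is a regular minimiser at level `k+1` for `W`
  have hbk := bg.isBackground k V hVdom
  have hmin : IsBackground av bg.reg (k+1) W (bg.U k V) := by
    refine ⟨?_, hbk.2.1, fun U hU hUW => ?_⟩
    · show (av k).avg (Averaging.iter av k (bg.U k V)) = W
      rw [hbk.1, hVW]
    · rw [hAeq]; exact hb1.2.2 U hU hUW
  -- [15] Thm 1, uniqueness of the critical orbit under the group (4)
  obtain ⟨u, hu1, hu⟩ := huniq _ hmin
  -- `V = M^k(U_k(V)) = (V^{(k)})^{u ↾ T^{(k)}}`
  have hVeq : V = GaugeField.gaugeAct (fun x => u (embIter k x)) Vk := by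
    rw [hVkdef, ← iter_gaugeAct av k (Nat.le_of_succ_le hk) u U₁, ← hu, hbk.1]
  -- the restricted gauge transformation is `1`: at the centres by (4), elsewhere by the two axial gauges
  have huk : ∀ x : Site P k, u (embIter k x) = 1 := by
    intro x
    by_cases hx : x = emb (blockOf x)
    · rw [hx]; exact hu1 (blockOf x)
    · have h1 := haxV (blockOf x) x rfl hx
      rw [hVeq, cd.covariant, hax (blockOf x) x rfl hx, mul_one] at h1
      have h2 : u (embIter k (emb (blockOf x))) = 1 := hu1 (blockOf x)
      rw [h2, one_mul, inv_eq_one] at h1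
      exact h1
  rw [hVeq]
  funext b
  show u (embIter k b.src) * Vk b * (u (embIter k b.tgt))⁻¹ = Vk b
  rw [huk, huk, inv_one, one_mul, mul_one]

end Main

/-! ## § 5  The matrix groups: faithfulness discharged for `U(N)` and `SU(N)` -/

section Matrix

variable {n : Type*} [DecidableEq n] [Fintype n] [Nonempty n]

/-- [cite: Balaban1987RG1, (2.2)–(2.3) p.265][cite: Balaban1985Variational, Thm 1 p.279] **(2.2)–(2.3) for
`G = U(N)`** (the tree's instance `UnitaryModel.instGaugeGroupUnitaryGroup`): as `criticalPoint23`, the trace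
hypothesis discharged. -/
theorem criticalPoint23_unitaryGroup {av : ∀ j, Averaging P j (Matrix.unitaryGroup n ℂ)}
    (bg : Background P (Matrix.unitaryGroup n ℂ) av) {k : ℕ} (hk : k + 1 ≤ P.m + P.K)
    (cd : ContourData P k (Matrix.unitaryGroup n ℂ)) (reg : Set (GaugeField P k (Matrix.unitaryGroup n ℂ)))
    {W : GaugeField P (k+1) (Matrix.unitaryGroup n ℂ)} (hW : W ∈ bg.dom (k+1))
    (hVk_dom : Averaging.iter av k (bg.U (k+1) W) ∈ bg.dom k)
    (hVk_reg : Averaging.iter av k (bg.U (k+1) W) ∈ reg)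
    (hreg : ∀ V ∈ reg, (av k).avg V = W → V ∈ bg.dom k)
    (hax : AxialGauge cd (Averaging.iter av k (bg.U (k+1) W)))
    (huniq : ∀ U₁, IsBackground av bg.reg (k+1) W U₁ →
      ∃ u : GaugeTransf P 0 (Matrix.unitaryGroup n ℂ), (∀ y : Site P (k+1), u (embIter (k+1) y) = 1) ∧
        U₁ = GaugeField.gaugeAct u (bg.U (k+1) W)) :
    CriticalPoint23 av bg k cd reg W :=
  criticalPoint23 eq_one_of_reTr_eq_one_unitaryGroup bg hk cd reg hW hVk_dom hVk_reg hreg hax huniq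

/-- [cite: Balaban1987RG1, (2.2)–(2.3) p.265][cite: Balaban1985Variational, Thm 1 p.279] **(2.2)–(2.3) for
`G = SU(N)`** (instance `UnitaryModel.instGaugeGroupSpecialUnitaryGroup`). -/
theorem criticalPoint23_specialUnitaryGroup {av : ∀ j, Averaging P j (Matrix.specialUnitaryGroup n ℂ)}
    (bg : Background P (Matrix.specialUnitaryGroup n ℂ) av) {k : ℕ} (hk : k + 1 ≤ P.m + P.K)
    (cd : ContourData P k (Matrix.specialUnitaryGroup n ℂ))
    (reg : Set (GaugeField P k (Matrix.specialUnitaryGroup n ℂ)))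
    {W : GaugeField P (k+1) (Matrix.specialUnitaryGroup n ℂ)} (hW : W ∈ bg.dom (k+1))
    (hVk_dom : Averaging.iter av k (bg.U (k+1) W) ∈ bg.dom k)
    (hVk_reg : Averaging.iter av k (bg.U (k+1) W) ∈ reg)
    (hreg : ∀ V ∈ reg, (av k).avg V = W → V ∈ bg.dom k)
    (hax : AxialGauge cd (Averaging.iter av k (bg.U (k+1) W)))
    (huniq : ∀ U₁, IsBackground av bg.reg (k+1) W U₁ →
      ∃ u : GaugeTransf P 0 (Matrix.specialUnitaryGroup n ℂ), (∀ y : Site P (k+1), u (embIter (k+1) y) = 1) ∧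
        U₁ = GaugeField.gaugeAct u (bg.U (k+1) W)) :
    CriticalPoint23 av bg k cd reg W :=
  criticalPoint23 eq_one_of_reTr_eq_one_specialUnitaryGroup bg hk cd reg hW hVk_dom hVk_reg hreg hax huniq

end Matrix

end Literature.MathematicalPhysics.QuantumFieldTheory.Balaban1983to89.B12CriticalPoint23
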